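import Summits.QuantumFields.YangMills.Theorems.LuscherReductionDressedRitzPolyakovLiftTransplant
import Summits.QuantumFields.YangMills.Theorems.LuscherReductionOneSiteLevelsValleyAlgebra
import Summits.QuantumFields.YangMills.Theorems.LuscherReductionOneSiteLevelsQuatPullback
import HarnessLib

/-!
# Route `LuscherReduction`, item `DressedRitz` (stmt-QuantumFields-20205), line «polyakovlift» r6 — THE POLYAKOV POWER MAP IS AN EXACT DILATION
# in the angle-linear chart: `expCoord μ (powLink L U) = expCoord (μ/L) U` on the principal shell (F5 of `R6-DESIGN.md`; LEAD prover g2)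

De Moivre on `SU(2)`: for a link `W = cos θ + sin θ n·σ` with `cos θ > 0` and `Lθ < π/2`, `W^L = cos Lθ + sin Lθ n·σ`, so the gnomonic coordinate of
`W^L` is `tan(Lθ) n` and its angle-linear coordinate `arctan(|gn|)·gn/|gn|` is `Lθ n = L ×` that of `W`.  Consequently the one-site shadow observable
`g_i ∘ powLink L` of a transplanted observable `g_i = G ∘ expCoord (Λ/2)` is `G ∘ expCoord (Λ/(2L))` on the principal shell — the transplant of the SAME flat
function at the one-site chart scale `μ_B = Λ/(2L)` of the coupling `B = 2L³/Λ³`.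

* `expLink W` (the angle-linear coordinate of one link), `expCoord_apply_of_pos` (`expCoord μ U (i,a) = expLink (U_i) a / μ`, `μ > 0`);
* `scalarPart_pow_vecPart_pow` (Chebyshev/de Moivre recursion), `expLink_pow` (`expLink (W^L) = L • expLink W` under `IsPrincipal L W`);
* ★ `expCoord_powLink` and `transplantObs_comp_powLink`.

HONEST FRAMING: chart algebra (conditional femto rung R2b1); nothing here bears on infinite volume, the continuum limit or the Clay gap.
References: Bröcker–tom Dieck I (1.10) [cite: BrockerTomDieck1985, I (1.10)]; M. Lüscher, NPB 219 (1983) 233 [cite: Luscher1983, §2].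
-/

set_option autoImplicit false

noncomputable section

open MeasureTheory Filter Topology Real
open Literature.MathematicalPhysics.QuantumFieldTheory (GaugeConfig Site gaugeTransform)
open Literature.Analysis.OperatorTheory.YMMatrixModel
open scoped BigOperators Matrix

namespace Summit.QuantumFields.YangMills.Theorems.FemtoTransferGap.PolyakovLift

open Summit.QuantumFields.YangMills.Theorems.FemtoTransferGap

/-! ## §1 The angle-linear coordinate of one link -/

/-- Euclidean length of the gnomonic coordinate `|gn W| = √(Σ_a gn_a²)`. [folklore] -/
def gnNorm (W : SU2) : ℝ := Real.sqrt (∑ a : Fin 3, gnLink W a ^ 2)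

/-- The ANGLE-LINEAR coordinate of one link: `expLink W = (arctan|gn W| / |gn W|) · gn W` (`= θ·n` for `±W = cos θ + sin θ n·σ`, `θ ∈ [0, π/2)`). [cite: BrockerTomDieck1985, I (1.10)] -/
def expLink (W : SU2) : Fin 3 → ℝ := fun a => atanc (gnNorm W) * gnLink W a

/-- `linkNormSq (gnCoord μ U) i = |gn(U_i)|² / μ²`. [folklore] -/
theorem linkNormSq_gnCoord (μ : ℝ) (U : Cfg) (i : Fin 3) :
    linkNormSq (gnCoord μ U) i = (∑ a : Fin 3, gnLink (U (edgeOf i)) a ^ 2) / μ ^ 2 := by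
  simp only [linkNormSq, gnCoord_apply, div_pow, Finset.sum_div]

/-- For `μ > 0`: `expCoord μ U (i,a) = expLink (U_i) a / μ`. [folklore] -/
theorem expCoord_apply_of_pos {μ : ℝ} (hμ : 0 < μ) (U : Cfg) (p : Fin 3 × Fin 3) :
    expCoord μ U p = expLink (U (edgeOf p.1)) p.2 / μ := by
  rw [expCoord, angleRescale_apply, gnCoord_apply, linkNormSq_gnCoord, Real.sqrt_div' _ (sq_nonneg μ), Real.sqrt_sq hμ.le,
    mul_div_cancel₀ _ hμ.ne', expLink, gnNorm]
  ring

/-! ## §2 De Moivre: scalar and vector parts of powers -/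

/-- `scalarPart 1 = 1`. [folklore] -/
theorem scalarPart_one : scalarPart (1 : SU2) = 1 := by
  rw [scalarPart, su2Quat_one]; rfl

/-- `vecPart 1 = 0`. [folklore] -/
theorem vecPart_one : vecPart (1 : SU2) = 0 := by
  funext a
  fin_cases a <;> simp [vecPart, su2Quat_one, Quaternion.imI_one, Quaternion.imJ_one, Quaternion.imK_one]

/-- The Chebyshev recursion for powers of a link: `scalarPart (W^m) = s_m`, `vecPart (W^m) = t_m • vecPart W` with
`s_{m+1} = s_m u₀ − t_m |u|²`, `t_{m+1} = s_m + u₀ t_m`, `s_0 = 1`, `t_0 = 0`. [cite: BrockerTomDieck1985, I (1.10)] -/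
def powSeq (u0 q : ℝ) : ℕ → ℝ × ℝ
  | 0 => (1, 0)
  | m + 1 => ((powSeq u0 q m).1 * u0 - (powSeq u0 q m).2 * q, (powSeq u0 q m).1 + u0 * (powSeq u0 q m).2)

/-- The recursion step of `powSeq`. [folklore] -/
theorem powSeq_succ (u0 q : ℝ) (m : ℕ) :
    powSeq u0 q (m + 1) = ((powSeq u0 q m).1 * u0 - (powSeq u0 q m).2 * q, (powSeq u0 q m).1 + u0 * (powSeq u0 q m).2) := rfl

/-- `scalarPart (W^m)` and `vecPart (W^m)` follow the Chebyshev recursion with `u₀ = scalarPart W`, `q = |vecPart W|²`. [cite: BrockerTomDieck1985, I (1.10)] -/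
theorem scalarPart_pow_vecPart_pow (W : SU2) (m : ℕ) :
    scalarPart (W ^ m) = (powSeq (scalarPart W) (∑ a, vecPart W a ^ 2) m).1 ∧
      vecPart (W ^ m) = (powSeq (scalarPart W) (∑ a, vecPart W a ^ 2) m).2 • vecPart W := by
  induction m with
  | zero => exact ⟨by rw [pow_zero, scalarPart_one]; rfl, by rw [pow_zero, vecPart_one]; simp [powSeq]⟩
  | succ m ih =>
    obtain ⟨h1, h2⟩ := ih
    have hvv : vecPart W ⬝ᵥ vecPart W = ∑ a, vecPart W a ^ 2 := vecPart_dot_self W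
    rw [powSeq_succ]
    constructor
    · rw [pow_succ, scalarPart_mul, h1, h2, smul_dotProduct, hvv, smul_eq_mul]
    · rw [pow_succ, vecPart_mul, h1, h2]
      have hc : (((powSeq (scalarPart W) (∑ a, vecPart W a ^ 2) m).2 • vecPart W) ⨯₃ vecPart W) = 0 := by
        rw [LinearMap.map_smul, LinearMap.smul_apply, cross_self, smul_zero]
      rw [hc, add_zero, smul_smul, ← add_smul, mul_comm]

/-- With `u₀ = cos θ`, `q = sin² θ`: `s_m = cos(mθ)` and `t_m · sin θ = sin(mθ)`. [folklore] -/
theorem powSeq_trig (θ : ℝ) (m : ℕ) :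
    (powSeq (Real.cos θ) (Real.sin θ ^ 2) m).1 = Real.cos (m * θ) ∧
      (powSeq (Real.cos θ) (Real.sin θ ^ 2) m).2 * Real.sin θ = Real.sin (m * θ) := by
  induction m with
  | zero => simp [powSeq]
  | succ m ih =>
    obtain ⟨h1, h2⟩ := ih
    rw [powSeq_succ]
    simp only [Nat.cast_succ, add_mul, one_mul, Real.cos_add, Real.sin_add]
    constructor
    · rw [h1, ← h2]; ring
    · rw [h1, show Real.cos θ * (powSeq (Real.cos θ) (Real.sin θ ^ 2) m).2 * Real.sin θ =
          Real.cos θ * ((powSeq (Real.cos θ) (Real.sin θ ^ 2) m).2 * Real.sin θ) by ring, h2]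
      ring

/-! ## §3 The dilation identity on the principal shell -/

/-- `W` is `L`-PRINCIPAL: positive scalar part and `L · arctan|gn W| < π/2` (the angle of `W` times `L` stays in the open hemisphere). [folklore] -/
def IsPrincipal (L : ℕ) (W : SU2) : Prop := 0 < scalarPart W ∧ (L : ℝ) * Real.arctan (gnNorm W) < π / 2

/-- `gnNorm W = √(1 − u₀²)/u₀ = tan(arccos u₀)` for `u₀ = scalarPart W > 0`. [folklore] -/
theorem gnNorm_eq_of_pos {W : SU2} (hs : 0 < scalarPart W) :
    gnNorm W = Real.sqrt (∑ a, vecPart W a ^ 2) / scalarPart W := by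
  unfold gnNorm
  simp_rw [gnLink_apply, div_pow, ← Finset.sum_div]
  rw [Real.sqrt_div' _ (sq_nonneg _), Real.sqrt_sq hs.le]

/-- `expLink 1 = 0`. [folklore] -/
theorem expLink_one : expLink (1 : SU2) = 0 := by
  funext a
  simp [expLink, gnLink_apply, vecPart_one]

/-- ★ De Moivre in the angle-linear coordinate: `expLink (W^L) = L • expLink W` for `L`-principal `W`. [cite: BrockerTomDieck1985, I (1.10)] -/
theorem expLink_pow {L : ℕ} {W : SU2} (h : IsPrincipal L W) : expLink (W ^ L) = (L : ℝ) • expLink W := by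
  obtain ⟨hs, hL⟩ := h
  rcases Nat.eq_zero_or_pos L with rfl | hLpos
  · simp [expLink_one]
  -- the angle `θ = arccos u₀ ∈ [0, π/2)`
  set s := scalarPart W with hsdef
  set v := vecPart W with hvdef
  set q : ℝ := ∑ a, v a ^ 2 with hqdef
  have hq : q = 1 - s ^ 2 := sum_vecPart_sq W
  have hq0 : 0 ≤ q := Finset.sum_nonneg fun _ _ => sq_nonneg _
  have hs1 : s ≤ 1 := (le_abs_self s).trans (abs_scalarPart_le W)
  set θ := Real.arccos s with hθdef
  have hcos : Real.cos θ = s := Real.cos_arccos (by linarith) hs1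
  have hsin : Real.sin θ = Real.sqrt q := by rw [hθdef, Real.sin_arccos, hq]
  have hθ0 : 0 ≤ θ := Real.arccos_nonneg s
  have hθlt : θ < π / 2 := Real.arccos_lt_pi_div_two.mpr hs
  have htan : gnNorm W = Real.tan θ := by rw [gnNorm_eq_of_pos hs, Real.tan_eq_sin_div_cos, hsin, hcos]
  have harc : Real.arctan (gnNorm W) = θ := by
    rw [htan]; exact Real.arctan_tan (by linarith [Real.pi_pos]) hθlt
  have hLθ : (L : ℝ) * θ < π / 2 := by rwa [harc] at hL
  have hL1 : (1 : ℝ) ≤ L := by exact_mod_cast hLpos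
  have hLθ0 : 0 ≤ (L : ℝ) * θ := mul_nonneg (by linarith) hθ0
  have hcosL : 0 < Real.cos ((L : ℝ) * θ) := Real.cos_pos_of_mem_Ioo ⟨by linarith [Real.pi_pos], hLθ⟩
  have hsinL : 0 ≤ Real.sin ((L : ℝ) * θ) := Real.sin_nonneg_of_nonneg_of_le_pi hLθ0 (by linarith [Real.pi_pos])
  -- powers of `W`
  obtain ⟨hsc, hvc⟩ := scalarPart_pow_vecPart_pow W L
  have hps : powSeq (scalarPart W) (∑ a, vecPart W a ^ 2) = powSeq (Real.cos θ) (Real.sin θ ^ 2) := by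
    rw [hcos, hsin, Real.sq_sqrt hq0]
  rw [hps] at hsc hvc
  obtain ⟨ht1, ht2⟩ := powSeq_trig θ L
  set T := (powSeq (Real.cos θ) (Real.sin θ ^ 2) L).2 with hTdef
  rw [ht1] at hsc
  -- the gnomonic coordinate of `W^L`
  have hgnL : ∀ a, gnLink (W ^ L) a = T * v a / Real.cos ((L : ℝ) * θ) := fun a => by
    rw [gnLink_apply, hsc, hvc, Pi.smul_apply, smul_eq_mul]
  have hnormL : gnNorm (W ^ L) = Real.tan ((L : ℝ) * θ) := by
    have hsL : 0 < scalarPart (W ^ L) := by rw [hsc]; exact hcosL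
    rw [gnNorm_eq_of_pos hsL, hsc, hvc]
    have hsum : ∑ a, (T • vecPart W) a ^ 2 = T ^ 2 * q := by
      simp only [Pi.smul_apply, smul_eq_mul, mul_pow, ← Finset.mul_sum]
      rfl
    rw [hsum, Real.sqrt_mul (sq_nonneg T), Real.sqrt_sq_eq_abs, ← hsin]
    have hT : |T| * Real.sin θ = Real.sin ((L : ℝ) * θ) := by
      have hsin0 : 0 ≤ Real.sin θ := by rw [hsin]; exact Real.sqrt_nonneg q
      rcases hsin0.eq_or_lt with h0 | hpos
      · -- `sin θ = 0`: then `sin (Lθ) = 0` too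
        rw [← h0, mul_zero]
        have := ht2; rw [← h0, mul_zero] at this; exact this
      · have hTnn : 0 ≤ T := (mul_nonneg_iff_of_pos_right hpos).1 (ht2 ▸ hsinL)
        rw [abs_of_nonneg hTnn, ht2]
    rw [hT, Real.tan_eq_sin_div_cos]
  -- conclude coordinatewise
  funext a
  rw [Pi.smul_apply, smul_eq_mul, expLink, expLink, hgnL, hnormL, htan, gnLink_apply]
  rcases hq0.eq_or_lt with hq00 | hqpos
  · -- `v = 0`
    have hva : v a = 0 := by
      have := (Finset.sum_eq_zero_iff_of_nonneg (fun b _ => sq_nonneg (v b))).1 hq00.symm a (Finset.mem_univ a)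
      exact pow_eq_zero_iff (n := 2) (by norm_num) |>.1 this
    rw [show vecPart W a = v a from rfl, hva]; simp
  · have hsinpos : 0 < Real.sin θ := by rw [hsin]; exact Real.sqrt_pos.mpr hqpos
    have hθpos : 0 < θ := by
      rcases hθ0.eq_or_lt with h0 | h0
      · exfalso; rw [← h0, Real.sin_zero] at hsinpos; exact lt_irrefl _ hsinpos
      · exact h0
    have hLθpos : 0 < (L : ℝ) * θ := mul_pos (by linarith) hθpos
    have htanpos : 0 < Real.tan θ := Real.tan_pos_of_pos_of_lt_pi_div_two hθpos hθlt
    have htanLpos : 0 < Real.tan ((L : ℝ) * θ) := Real.tan_pos_of_pos_of_lt_pi_div_two hLθpos hLθ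
    have hsinLpos : 0 < Real.sin ((L : ℝ) * θ) := Real.sin_pos_of_pos_of_lt_pi hLθpos (by linarith [Real.pi_pos])
    have hT : T = Real.sin ((L : ℝ) * θ) / Real.sin θ := by rw [← ht2, mul_div_cancel_right₀ _ hsinpos.ne']
    have ha1 : atanc (Real.tan ((L : ℝ) * θ)) = (L : ℝ) * θ / Real.tan ((L : ℝ) * θ) := by
      rw [atanc, if_neg htanLpos.ne', Real.arctan_tan (by linarith) hLθ]
    have ha2 : atanc (Real.tan θ) = θ / Real.tan θ := by
      rw [atanc, if_neg htanpos.ne', Real.arctan_tan (by linarith) hθlt]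
    rw [ha1, ha2, hT, Real.tan_eq_sin_div_cos, Real.tan_eq_sin_div_cos, hcos, show vecPart W a = v a from rfl, ← hsdef]
    field_simp

/-- `powLink` unfolded on a link. [folklore] -/
theorem powLink_apply (L : ℕ) (U : Cfg) (e : Literature.MathematicalPhysics.QuantumFieldTheory.Edge 3 1) : powLink L U e = U e ^ L := rfl

/-- ★★ **The Polyakov power map is an exact dilation in the angle-linear chart**: `expCoord μ (powLink L U) = expCoord (μ/L) U` whenever every link of `U`
is `L`-principal (`μ > 0`, `L ≥ 1`). [cite: Luscher1983, §2] -/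
theorem expCoord_powLink {μ : ℝ} (hμ : 0 < μ) {L : ℕ} (hL : 0 < L) {U : Cfg} (hU : ∀ i : Fin 3, IsPrincipal L (U (edgeOf i))) :
    expCoord μ (powLink L U) = expCoord (μ / L) U := by
  have hL' : (0 : ℝ) < L := Nat.cast_pos.mpr hL
  ext p
  rw [expCoord_apply_of_pos hμ, expCoord_apply_of_pos (div_pos hμ hL'), powLink_apply, expLink_pow (hU p.1), Pi.smul_apply, smul_eq_mul]
  field_simp

/-- ★★ The shadow observable of a transplanted observable is the transplant of the SAME flat function at the one-site chart scale:
`transplantObs Λ R f i (powLink L U) = transplantFn R f i (expCoord (Λ/(2L)) U)` on the principal shell. [cite: Luscher1983, §2–§3] -/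
theorem transplantObs_comp_powLink {k : ℕ} {Λ : ℝ} (hΛ : 0 < Λ) (R : ℝ) (f : Fin (k + 1) → ZM → ℝ) (i : Fin k) {L : ℕ} (hL : 0 < L)
    {U : Cfg} (hU : ∀ j : Fin 3, IsPrincipal L (U (edgeOf j))) :
    transplantObs Λ R f i (powLink L U) = transplantFn R f i (expCoord (Λ / (2 * L)) U) := by
  rw [transplantObs, expCoord_powLink (half_pos hΛ) hL hU, div_div]

end Summit.QuantumFields.YangMills.Theorems.FemtoTransferGap.PolyakovLift

end
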